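import Mathlib
import Summits.KontsevichZagierPeriods.KontsevichZagierPeriods.Theorems.InverseLandauTateFamilyKernelStubGpCertificate

/-!
# Crux `TateFamilyKernel` (stmt-KontsevichZagierPeriods-9130), line `Sketch`:
# stub `stub_gvCertificate`

Step GV4 (CERTIFICATE, pure algebra) of the linear-slope graph-pencil class of the lead's skeleton
of the crux
`Summit.KontsevichZagierPeriods.KontsevichZagierPeriods.Theses.InverseLandau.TateFamilyKernel`.
Variables: `X 0 = z₁`, `X 1 = z₂`, `X 2 = ϖ`; slope `V = γ + δ z₂` (`C γ + C δ * X 1`), twisted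
coefficient `L = u′(z₂) + δ z₁`, Tate denominator `Q = 1 − ϖ·(u(z₂) + V z₁) ∈ ℚ[z₁, z₂, ϖ]` with
`u ∈ ℚ[s]`, `γ δ ∈ ℚ`.

If the `ϖ`-free numerator satisfies the TWISTED IDENTITY
`V^m P = L·∂₀Ñ − V·∂₁Ñ + mδ·Ñ` for a polynomial `Ñ ∈ ℚ[z₁,z₂]`, then `P/Q` is Griffiths-exact with
the polynomial denominator `D = Q·V^m`:
`P/Q = ∂₀(LÑ/D) + ∂₁(−VÑ/D)`. Indeed `∂₀Q = −ϖV`, `∂₁Q = −ϖL` make the two `Q⁻²` cross terms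
`±ϖVLÑ` cancel, `∂₀V^m = 0`, and `V·∂₁V^m = mδ·V^m` produces exactly the zeroth-order term of
the twisted identity. The statement is the pointwise form of this identity at a real point
`(w, ϖ)` where `Q ≠ 0` and `V ≠ 0`, with both quotient-rule numerators written out
(`∂ᵢ(Aᵢ/D) = (∂ᵢAᵢ·D − Aᵢ·∂ᵢD)/D²`, `A₀ = LÑ`, `A₁ = −VÑ`, lifted to three variables by
`rename Fin.castSucc`).

Proof: the polynomial identities `∂₀Q = −(ϖ·V)`, `∂₁Q = −(ϖ·L)`, `∂₀V = 0`, `∂₁V = δ`,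
`∂₁V^m = m V^(m-1) δ` (`MvPolynomial.pderiv_pow`), `∂ᵢ ∘ rename castSucc = rename castSucc ∘ ∂ᵢ`
(from the sibling file `…StubGpCertificate`, namespace `GpCertificate`); after evaluating by the
algebra map `aeval (Fin.snoc w ϖ)` and substituting `P = (…)/V^m` from the evaluated twisted
identity, the claim is a field identity in real atoms: clear the denominators `V^m·Q` and
`(Q·V^m)²` (`div_eq_div_iff`), then `ring` (after `cases m` to dispose of the truncated exponent
`m - 1`).

References: Kontsevich–Zagier 2001, §1.2 (an elementary algebraic step of one test class of the
period conjecture). Mathlib and the sibling certificate file only; no named fact, no new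
definition. Helpers live in the sub-namespace `GvCertificate`.
-/

noncomputable section

open MvPolynomial

namespace Summit.KontsevichZagierPeriods.InverseLandau.TateFamilyKernel.Descent

namespace GvCertificate

/-! ### The slope `V = γ + δ z₂` and the twisted coefficient `L = u′(z₂) + δ z₁` -/

/-- `∂₀ V = 0` for the slope `V = γ + δ X₁` (it is `z₁`-free). [folklore] -/
theorem pderiv_zero_gvV (γ δ : ℚ) :
    pderiv 0 (C γ + C δ * X 1 : MvPolynomial (Fin (2 + 1)) ℚ) = 0 := by
  have h10 : (1 : Fin (2 + 1)) ≠ 0 := by decide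
  rw [map_add, pderiv_C, pderiv_C_mul, pderiv_X_of_ne h10, mul_zero, add_zero]

/-- `∂₁ V = δ` for the slope `V = γ + δ X₁`. [folklore] -/
theorem pderiv_one_gvV (γ δ : ℚ) :
    pderiv 1 (C γ + C δ * X 1 : MvPolynomial (Fin (2 + 1)) ℚ) = C δ := by
  rw [map_add, pderiv_C, pderiv_C_mul, pderiv_X_self, mul_one, zero_add]

/-- `∂₀ L = δ` for the twisted coefficient `L = u′(X₁) + δ X₀`. [folklore] -/
theorem pderiv_zero_gvL (u : Polynomial ℚ) (δ : ℚ) :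
    pderiv 0 (Polynomial.aeval (X 1 : MvPolynomial (Fin (2 + 1)) ℚ) (Polynomial.derivative u) +
        C δ * X 0) = C δ := by
  have h10 : (1 : Fin (2 + 1)) ≠ 0 := by decide
  rw [map_add, GpCertificate.pderiv_polyAeval_of_ne h10, pderiv_C_mul, pderiv_X_self, mul_one,
    zero_add]

/-! ### The partial derivatives of the Tate denominator `Q = 1 − ϖ(u(z₂) + V z₁)` -/

/-- `∂₀ Q = −ϖV` for `Q = 1 − X₂·(u(X₁) + V X₀)`, `V = γ + δ X₁`. [folklore] -/
theorem pderiv_zero_gvQ (u : Polynomial ℚ) (γ δ : ℚ) :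
    pderiv 0 (1 - X 2 * (Polynomial.aeval (X 1 : MvPolynomial (Fin (2 + 1)) ℚ) u +
        (C γ + C δ * X 1) * X 0)) =
      -(X 2 * (C γ + C δ * X 1)) := by
  have h10 : (1 : Fin (2 + 1)) ≠ 0 := by decide
  have h20 : (2 : Fin (2 + 1)) ≠ 0 := by decide
  rw [map_sub, Derivation.map_one_eq_zero, pderiv_mul, pderiv_X_of_ne h20, map_add,
    GpCertificate.pderiv_polyAeval_of_ne h10, pderiv_mul, pderiv_zero_gvV, pderiv_X_self]
  ring

/-- `∂₁ Q = −ϖL` for `Q = 1 − X₂·(u(X₁) + V X₀)`, `L = u′(X₁) + δ X₀`. [folklore] -/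
theorem pderiv_one_gvQ (u : Polynomial ℚ) (γ δ : ℚ) :
    pderiv 1 (1 - X 2 * (Polynomial.aeval (X 1 : MvPolynomial (Fin (2 + 1)) ℚ) u +
        (C γ + C δ * X 1) * X 0)) =
      -(X 2 * (Polynomial.aeval (X 1 : MvPolynomial (Fin (2 + 1)) ℚ) (Polynomial.derivative u) +
        C δ * X 0)) := by
  have h01 : (0 : Fin (2 + 1)) ≠ 1 := by decide
  have h21 : (2 : Fin (2 + 1)) ≠ 1 := by decide
  rw [map_sub, Derivation.map_one_eq_zero, pderiv_mul, pderiv_X_of_ne h21, map_add,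
    GpCertificate.pderiv_polyAeval_self, pderiv_mul, pderiv_one_gvV, pderiv_X_of_ne h01]
  ring

/-! ### Lifting from `ℚ[z₁,z₂]` to `ℚ[z₁,z₂,ϖ]` by `rename Fin.castSucc` -/

/-- The lift of the slope: `rename castSucc (γ + δ X₁) = γ + δ X₁`. [folklore] -/
theorem rename_gvV (γ δ : ℚ) :
    (rename Fin.castSucc (C γ + C δ * X 1 : MvPolynomial (Fin 2) ℚ) :
        MvPolynomial (Fin (2 + 1)) ℚ) = C γ + C δ * X 1 := by
  rw [map_add, map_mul, rename_C, rename_C, rename_X, Fin.castSucc_one]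

/-- The lift of a power of the slope: `rename castSucc ((γ + δ X₁)^m) = (γ + δ X₁)^m`.
[folklore] -/
theorem rename_gvV_pow (γ δ : ℚ) (m : ℕ) :
    (rename Fin.castSucc ((C γ + C δ * X 1 : MvPolynomial (Fin 2) ℚ) ^ m) :
        MvPolynomial (Fin (2 + 1)) ℚ) = (C γ + C δ * X 1) ^ m := by
  rw [map_pow, rename_gvV]

/-- The lift of the twisted coefficient: `rename castSucc (u′(X₁) + δ X₀) = u′(X₁) + δ X₀`.
[folklore] -/
theorem rename_gvL (u : Polynomial ℚ) (δ : ℚ) :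
    (rename Fin.castSucc
        (Polynomial.aeval (X 1 : MvPolynomial (Fin 2) ℚ) (Polynomial.derivative u) + C δ * X 0) :
          MvPolynomial (Fin (2 + 1)) ℚ) =
      Polynomial.aeval (X 1 : MvPolynomial (Fin (2 + 1)) ℚ) (Polynomial.derivative u) +
        C δ * X 0 := by
  rw [map_add, map_mul, GpCertificate.rename_polyAeval, rename_C, rename_X, Fin.castSucc_zero]

/-- The lifted datum `A₀ = L·Ñ`: `rename castSucc (L Ñ) = L · rename castSucc Ñ`. [folklore] -/
theorem rename_gvA0 (u : Polynomial ℚ) (δ : ℚ) (N : MvPolynomial (Fin 2) ℚ) :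
    (rename Fin.castSucc
        ((Polynomial.aeval (X 1 : MvPolynomial (Fin 2) ℚ) (Polynomial.derivative u) + C δ * X 0) *
          N) : MvPolynomial (Fin (2 + 1)) ℚ) =
      (Polynomial.aeval (X 1 : MvPolynomial (Fin (2 + 1)) ℚ) (Polynomial.derivative u) +
          C δ * X 0) * rename Fin.castSucc N := by
  rw [map_mul, rename_gvL]

/-- `∂₀` of the lifted datum `A₀ = L·Ñ`: `∂₀(L Ñ) = δ Ñ + L ∂₀Ñ`. [folklore] -/
theorem pderiv_zero_gvA0 (u : Polynomial ℚ) (δ : ℚ) (N : MvPolynomial (Fin 2) ℚ) :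
    pderiv 0 ((Polynomial.aeval (X 1 : MvPolynomial (Fin (2 + 1)) ℚ) (Polynomial.derivative u) +
        C δ * X 0) * rename Fin.castSucc N) =
      C δ * rename Fin.castSucc N +
        (Polynomial.aeval (X 1 : MvPolynomial (Fin (2 + 1)) ℚ) (Polynomial.derivative u) +
          C δ * X 0) * rename Fin.castSucc (pderiv 0 N) := by
  rw [pderiv_mul, pderiv_zero_gvL, GpCertificate.pderiv_zero_rename]

/-- The lifted datum `A₁ = −V·Ñ`: `rename castSucc (−(V Ñ)) = −(V · rename castSucc Ñ)`.
[folklore] -/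
theorem rename_gvA1 (γ δ : ℚ) (N : MvPolynomial (Fin 2) ℚ) :
    (rename Fin.castSucc (-((C γ + C δ * X 1) * N)) : MvPolynomial (Fin (2 + 1)) ℚ) =
      -((C γ + C δ * X 1) * rename Fin.castSucc N) := by
  rw [map_neg, map_mul, rename_gvV]

/-- `∂₁` of the lifted datum `A₁ = −V·Ñ`: `∂₁(−V Ñ) = −(δ Ñ + V ∂₁Ñ)`. [folklore] -/
theorem pderiv_one_gvA1 (γ δ : ℚ) (N : MvPolynomial (Fin 2) ℚ) :
    pderiv 1 (-((C γ + C δ * X 1) * rename Fin.castSucc N) : MvPolynomial (Fin (2 + 1)) ℚ) =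
      -(C δ * rename Fin.castSucc N + (C γ + C δ * X 1) * rename Fin.castSucc (pderiv 1 N)) := by
  rw [map_neg, pderiv_mul, pderiv_one_gvV, GpCertificate.pderiv_one_rename]

/-! ### The partial derivatives of the Griffiths denominator `D = Q · V^m` -/

/-- `∂₀ D = −ϖV · V^m` for `D = Q · V^m` (`∂₀ V^m = 0`). [folklore] -/
theorem pderiv_zero_gvD (u : Polynomial ℚ) (γ δ : ℚ) (m : ℕ) :
    pderiv 0 ((1 - X 2 * (Polynomial.aeval (X 1 : MvPolynomial (Fin (2 + 1)) ℚ) u +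
        (C γ + C δ * X 1) * X 0)) * (C γ + C δ * X 1) ^ m) =
      -(X 2 * (C γ + C δ * X 1)) * (C γ + C δ * X 1) ^ m := by
  rw [pderiv_mul, pderiv_zero_gvQ, pderiv_pow, pderiv_zero_gvV, mul_zero, mul_zero, add_zero]

/-- `∂₁ D = −ϖL · V^m + Q · (m V^(m-1) δ)` for `D = Q · V^m`. [folklore] -/
theorem pderiv_one_gvD (u : Polynomial ℚ) (γ δ : ℚ) (m : ℕ) :
    pderiv 1 ((1 - X 2 * (Polynomial.aeval (X 1 : MvPolynomial (Fin (2 + 1)) ℚ) u +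
        (C γ + C δ * X 1) * X 0)) * (C γ + C δ * X 1) ^ m) =
      -(X 2 * (Polynomial.aeval (X 1 : MvPolynomial (Fin (2 + 1)) ℚ) (Polynomial.derivative u) +
            C δ * X 0)) * (C γ + C δ * X 1) ^ m +
        (1 - X 2 * (Polynomial.aeval (X 1 : MvPolynomial (Fin (2 + 1)) ℚ) u +
            (C γ + C δ * X 1) * X 0)) *
          ((m : MvPolynomial (Fin (2 + 1)) ℚ) * (C γ + C δ * X 1) ^ (m - 1) * C δ) := by
  rw [pderiv_mul, pderiv_one_gvQ, pderiv_pow, pderiv_one_gvV]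

/-- The extended point `snoc w ϖ` at the lifted index `1 = castSucc 1`: `snoc w ϖ 1 = w 1`.
[folklore] -/
theorem snoc_one (ϖ : ℝ) (w : Fin 2 → ℝ) : (Fin.snoc w ϖ : Fin (2 + 1) → ℝ) 1 = w 1 := rfl

end GvCertificate

/-- STUB `stub_gvCertificate` (linear-slope graph-pencil class, step GV4: CERTIFICATE, pure
algebra). The twisted identity `V^m P = L ∂₀Ñ − V ∂₁Ñ + mδ Ñ` (`V = γ + δz₂`, `L = u′(z₂) + δz₁`)
makes `P/Q` Griffiths-exact with denominator `D = Q·V^m`, `Q = 1 − ϖ(u(z₂) + Vz₁)`: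
`P/Q = ∂₀(LÑ/D) + ∂₁(−VÑ/D)` pointwise wherever `Q ≠ 0` and `V ≠ 0` (the `Q⁻²` cross terms
`±ϖVLÑ` cancel since `∂₀Q = −ϖV`, `∂₁Q = −ϖL`, and `V ∂₁V^m = mδ V^m`), written with both
quotient-rule numerators spelled out and the data `A = (LÑ, −VÑ)` lifted by `rename Fin.castSucc`.
[cite: KontsevichZagier2001, §1.2] -/
theorem stub_gvCertificate (u : Polynomial ℚ) (γ δ : ℚ) (P Nt : MvPolynomial (Fin 2) ℚ) (m : ℕ)
    (hN : (C γ + C δ * X 1) ^ m * P =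
      (Polynomial.aeval (X 1 : MvPolynomial (Fin 2) ℚ) (Polynomial.derivative u) + C δ * X 0) * pderiv 0 Nt -
        (C γ + C δ * X 1) * pderiv 1 Nt + C ((m : ℚ) * δ) * Nt)
    (ϖ : ℝ) (w : Fin 2 → ℝ) (hv : (γ : ℝ) + δ * w 1 ≠ 0)
    (hQ : aeval (Fin.snoc w ϖ : Fin (2 + 1) → ℝ)
      (1 - X 2 * (Polynomial.aeval (X 1 : MvPolynomial (Fin (2 + 1)) ℚ) u + (C γ + C δ * X 1) * X 0)) ≠ 0) :
    aeval (Fin.snoc w ϖ : Fin (2 + 1) → ℝ) (rename Fin.castSucc P) /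
        aeval (Fin.snoc w ϖ : Fin (2 + 1) → ℝ)
          (1 - X 2 * (Polynomial.aeval (X 1 : MvPolynomial (Fin (2 + 1)) ℚ) u + (C γ + C δ * X 1) * X 0)) =
      aeval (Fin.snoc w ϖ : Fin (2 + 1) → ℝ)
          (pderiv 0 (rename Fin.castSucc
              ((Polynomial.aeval (X 1 : MvPolynomial (Fin 2) ℚ) (Polynomial.derivative u) + C δ * X 0) * Nt)) *
              ((1 - X 2 * (Polynomial.aeval (X 1 : MvPolynomial (Fin (2 + 1)) ℚ) u + (C γ + C δ * X 1) * X 0)) *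
                rename Fin.castSucc ((C γ + C δ * X 1) ^ m)) -
            rename Fin.castSucc
                ((Polynomial.aeval (X 1 : MvPolynomial (Fin 2) ℚ) (Polynomial.derivative u) + C δ * X 0) * Nt) *
              pderiv 0 ((1 - X 2 * (Polynomial.aeval (X 1 : MvPolynomial (Fin (2 + 1)) ℚ) u +
                (C γ + C δ * X 1) * X 0)) * rename Fin.castSucc ((C γ + C δ * X 1) ^ m))) /
        aeval (Fin.snoc w ϖ : Fin (2 + 1) → ℝ)
          (((1 - X 2 * (Polynomial.aeval (X 1 : MvPolynomial (Fin (2 + 1)) ℚ) u + (C γ + C δ * X 1) * X 0)) *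
            rename Fin.castSucc ((C γ + C δ * X 1) ^ m)) ^ 2) +
      aeval (Fin.snoc w ϖ : Fin (2 + 1) → ℝ)
          (pderiv 1 (rename Fin.castSucc (-((C γ + C δ * X 1) * Nt))) *
              ((1 - X 2 * (Polynomial.aeval (X 1 : MvPolynomial (Fin (2 + 1)) ℚ) u + (C γ + C δ * X 1) * X 0)) *
                rename Fin.castSucc ((C γ + C δ * X 1) ^ m)) -
            rename Fin.castSucc (-((C γ + C δ * X 1) * Nt)) *
              pderiv 1 ((1 - X 2 * (Polynomial.aeval (X 1 : MvPolynomial (Fin (2 + 1)) ℚ) u +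
                (C γ + C δ * X 1) * X 0)) * rename Fin.castSucc ((C γ + C δ * X 1) ^ m))) /
        aeval (Fin.snoc w ϖ : Fin (2 + 1) → ℝ)
          (((1 - X 2 * (Polynomial.aeval (X 1 : MvPolynomial (Fin (2 + 1)) ℚ) u + (C γ + C δ * X 1) * X 0)) *
            rename Fin.castSucc ((C γ + C δ * X 1) ^ m)) ^ 2) := by
  -- polynomial-level computation of the four partial derivatives
  rw [GvCertificate.rename_gvA0, GvCertificate.rename_gvA1, GvCertificate.rename_gvV_pow,
    GvCertificate.pderiv_zero_gvA0, GvCertificate.pderiv_one_gvA1, GvCertificate.pderiv_zero_gvD,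
    GvCertificate.pderiv_one_gvD]
  -- the twisted identity, lifted and evaluated at the point
  have hN' :=
    congrArg (fun F => aeval (Fin.snoc w ϖ : Fin (2 + 1) → ℝ) (rename Fin.castSucc F)) hN
  simp only [map_mul, map_pow, map_add, map_sub] at hN'
  simp only [rename_C, rename_X, Fin.castSucc_one, Fin.castSucc_zero,
    GpCertificate.rename_polyAeval, map_natCast] at hN'
  -- evaluate the goal
  simp only [map_sub, map_add, map_mul, map_neg, map_pow, map_one, map_natCast] at hQ hN' ⊢
  have hv' : aeval (Fin.snoc w ϖ : Fin (2 + 1) → ℝ) (C γ : MvPolynomial (Fin (2 + 1)) ℚ) +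
      aeval (Fin.snoc w ϖ : Fin (2 + 1) → ℝ) (C δ : MvPolynomial (Fin (2 + 1)) ℚ) *
        aeval (Fin.snoc w ϖ : Fin (2 + 1) → ℝ) (X 1 : MvPolynomial (Fin (2 + 1)) ℚ) ≠ 0 := by
    rwa [MvPolynomial.aeval_C, MvPolynomial.aeval_C, MvPolynomial.aeval_X, eq_ratCast, eq_ratCast,
      GvCertificate.snoc_one]
  have hp := eq_div_of_mul_eq (pow_ne_zero m hv') ((mul_comm _ _).trans hN')
  -- clear the denominators `V^m · Q` and `(Q · V^m)²`
  rw [hp, ← add_div, div_div, div_eq_div_iff (mul_ne_zero (pow_ne_zero m hv') hQ)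
    (pow_ne_zero 2 (mul_ne_zero hQ (pow_ne_zero m hv')))]
  cases m with
  | zero =>
    simp only [pow_zero, Nat.cast_zero, zero_mul, mul_zero, mul_one, add_zero]
    ring
  | succ n =>
    simp only [Nat.add_sub_cancel, Nat.cast_succ]
    ring

end Summit.KontsevichZagierPeriods.InverseLandau.TateFamilyKernel.Descent
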